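import Summits.Ventures.CertifiedArithmetic.LowPrec.EnvelopesDirectedE2M1

/-!
# Directed-mode (RZ / RD / RU) normal-range relative constants, destination `E2M3` (products)

HONEST FRAMING (venture CertifiedArithmetic / cell `pub-lowprec`): certified error envelopes and
provably optimal rounding/accumulation schemes for low-precision formats under stated cost models;
every table by two implementations; no hardware or vendor claims.

The kernel third implementation of the RNE self-destination tables of the nine FP6/FP4 ordered
pairs is `EnvelopesE2M1/E3M2/E2M3`, `EnvelopesMixedE3M2/E2M3`, `EnvelopesMixedFP4`. This file adds
the DIRECTED columns of ENVELOPES.md / paper Table 2 for the three rows `E2M3 ∘ Y → E2M3`,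
`Y ∈ {E3M2, E2M3, E2M1}`, `∘ = ×` (by commutativity the enum seat's ordered tables with the
operands exchanged are the transposes; sibling file: the other operation):
for each row and each of `roundTowardZero`
(RZ), `roundDown` (RD), `roundUp` (RU) the SHARP relative constant on the destination's normal
range `1 ≤ |t| ≤ maxRat` — a bound over all in-range pairs AND an explicit maximiser — by
`decide +kernel` over all operand pairs. `max RU = max RD` on every row (sign symmetry `RU(-t) =
-RD(t)`; both columns are proved with the same constant and each is attained). Constants:
`E2M3*E2M3` RZ 15/143, RD=RU 7/65; `E2M3*E3M2` RZ 3/35, RD=RU 7/65; `E2M3*E2M1` RZ 1/13, RD=RU 1/11.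
They were computed by an exact evaluator (enum seat, `HOME/lean/enum/dir_envelopes.py`,
Fractions only, no code shared with implementations A/B) and agree with the certified campaign
tables (certs/enum/canary, certs/enum/fp6fp4mixed: implementation A = implementation B = the
referee's route) on all 18 rows × 2 columns. Below the normal range the directed relative error
reaches `1` (results flushed to `0`), so no global constant `< 1` exists; the absolute directed
envelope (`< 1 ulp` per binade) is the generic Theorem E2 (`DirectedEnvelope`).
-/

namespace Summit.Ventures.CertifiedArithmetic

open Literature.ComputerArithmetic.FloatingPoint
open Literature.ComputerArithmetic.FloatingPoint.MiniFloat
open Literature.ComputerArithmetic.FloatingPoint.Format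


/-- `E2M3 * E2M3 → E2M3` under `RZ` (`roundTowardZero`): on the normal range `1 ≤ |t| ≤ 15 / 2`
of `E2M3` every in-range product satisfies `|fl(t) - t| ≤ 15 / 143 · |t|`, and `15 / 143` is
attained (`a = 11 / 8`, `b = 13 / 8`: `t = 143 / 64 ↦ 2`); kernel-exhaustive over all
`64 × 64` ordered pairs. -/
theorem E2M3_E2M3_mul_E2M3_relRZ_normal :
    (∀ (a : MiniFloat E2M3) (b : MiniFloat E2M3),
        (1 : ℚ) ≤ |a.toRat * b.toRat| → |a.toRat * b.toRat| ≤ E2M3.maxRat →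
          |(roundTowardZero E2M3 (a.toRat * b.toRat)).toRat - (a.toRat * b.toRat)|
            ≤ 15 / 143 * |a.toRat * b.toRat|) ∧
      ∃ (a : MiniFloat E2M3) (b : MiniFloat E2M3),
        (1 : ℚ) ≤ |a.toRat * b.toRat| ∧ |a.toRat * b.toRat| ≤ E2M3.maxRat ∧
          |(roundTowardZero E2M3 (a.toRat * b.toRat)).toRat - (a.toRat * b.toRat)|
            = 15 / 143 * |a.toRat * b.toRat| :=
  ⟨fun a b => of_decide_eq_true (forall₂_of_all_all
      (P := relDirTest E2M3 (roundTowardZero E2M3) (· * ·) (1) (15 / 143))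
      (by decide +kernel) a b),
    ⟨false, 1, 3, by decide, by decide, by decide⟩,
    ⟨false, 1, 5, by decide, by decide, by decide⟩, by decide +kernel⟩

/-- `E2M3 * E2M3 → E2M3` under `RD` (`roundDown`): on the normal range `1 ≤ |t| ≤ 15 / 2`
of `E2M3` every in-range product satisfies `|fl(t) - t| ≤ 7 / 65 · |t|`, and `7 / 65` is
attained (`a = 5 / 8`, `b = -13 / 8`: `t = -65 / 64 ↦ -9 / 8`); kernel-exhaustive over all
`64 × 64` ordered pairs. -/
theorem E2M3_E2M3_mul_E2M3_relRD_normal :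
    (∀ (a : MiniFloat E2M3) (b : MiniFloat E2M3),
        (1 : ℚ) ≤ |a.toRat * b.toRat| → |a.toRat * b.toRat| ≤ E2M3.maxRat →
          |(roundDown E2M3 (a.toRat * b.toRat)).toRat - (a.toRat * b.toRat)|
            ≤ 7 / 65 * |a.toRat * b.toRat|) ∧
      ∃ (a : MiniFloat E2M3) (b : MiniFloat E2M3),
        (1 : ℚ) ≤ |a.toRat * b.toRat| ∧ |a.toRat * b.toRat| ≤ E2M3.maxRat ∧
          |(roundDown E2M3 (a.toRat * b.toRat)).toRat - (a.toRat * b.toRat)|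
            = 7 / 65 * |a.toRat * b.toRat| :=
  ⟨fun a b => of_decide_eq_true (forall₂_of_all_all
      (P := relDirTest E2M3 (roundDown E2M3) (· * ·) (1) (7 / 65))
      (by decide +kernel) a b),
    ⟨false, 0, 5, by decide, by decide, by decide⟩,
    ⟨true, 1, 5, by decide, by decide, by decide⟩, by decide +kernel⟩

/-- `E2M3 * E2M3 → E2M3` under `RU` (`roundUp`): on the normal range `1 ≤ |t| ≤ 15 / 2`
of `E2M3` every in-range product satisfies `|fl(t) - t| ≤ 7 / 65 · |t|`, and `7 / 65` is
attained (`a = 5 / 8`, `b = 13 / 8`: `t = 65 / 64 ↦ 9 / 8`); kernel-exhaustive over all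
`64 × 64` ordered pairs. -/
theorem E2M3_E2M3_mul_E2M3_relRU_normal :
    (∀ (a : MiniFloat E2M3) (b : MiniFloat E2M3),
        (1 : ℚ) ≤ |a.toRat * b.toRat| → |a.toRat * b.toRat| ≤ E2M3.maxRat →
          |(roundUp E2M3 (a.toRat * b.toRat)).toRat - (a.toRat * b.toRat)|
            ≤ 7 / 65 * |a.toRat * b.toRat|) ∧
      ∃ (a : MiniFloat E2M3) (b : MiniFloat E2M3),
        (1 : ℚ) ≤ |a.toRat * b.toRat| ∧ |a.toRat * b.toRat| ≤ E2M3.maxRat ∧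
          |(roundUp E2M3 (a.toRat * b.toRat)).toRat - (a.toRat * b.toRat)|
            = 7 / 65 * |a.toRat * b.toRat| :=
  ⟨fun a b => of_decide_eq_true (forall₂_of_all_all
      (P := relDirTest E2M3 (roundUp E2M3) (· * ·) (1) (7 / 65))
      (by decide +kernel) a b),
    ⟨false, 0, 5, by decide, by decide, by decide⟩,
    ⟨false, 1, 5, by decide, by decide, by decide⟩, by decide +kernel⟩

/-- `E2M3 * E3M2 → E2M3` under `RZ` (`roundTowardZero`): on the normal range `1 ≤ |t| ≤ 15 / 2`
of `E2M3` every in-range product satisfies `|fl(t) - t| ≤ 3 / 35 · |t|`, and `3 / 35` is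
attained (`a = 5 / 8`, `b = 7 / 4`: `t = 35 / 32 ↦ 1`); kernel-exhaustive over all
`64 × 64` ordered pairs. -/
theorem E2M3_E3M2_mul_E2M3_relRZ_normal :
    (∀ (a : MiniFloat E2M3) (b : MiniFloat E3M2),
        (1 : ℚ) ≤ |a.toRat * b.toRat| → |a.toRat * b.toRat| ≤ E2M3.maxRat →
          |(roundTowardZero E2M3 (a.toRat * b.toRat)).toRat - (a.toRat * b.toRat)|
            ≤ 3 / 35 * |a.toRat * b.toRat|) ∧
      ∃ (a : MiniFloat E2M3) (b : MiniFloat E3M2),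
        (1 : ℚ) ≤ |a.toRat * b.toRat| ∧ |a.toRat * b.toRat| ≤ E2M3.maxRat ∧
          |(roundTowardZero E2M3 (a.toRat * b.toRat)).toRat - (a.toRat * b.toRat)|
            = 3 / 35 * |a.toRat * b.toRat| :=
  ⟨fun a b => of_decide_eq_true (forall₂_of_all_all
      (P := relDirTest E2M3 (roundTowardZero E2M3) (· * ·) (1) (3 / 35))
      (by decide +kernel) a b),
    ⟨false, 0, 5, by decide, by decide, by decide⟩,
    ⟨false, 3, 3, by decide, by decide, by decide⟩, by decide +kernel⟩

/-- `E2M3 * E3M2 → E2M3` under `RD` (`roundDown`): on the normal range `1 ≤ |t| ≤ 15 / 2`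
of `E2M3` every in-range product satisfies `|fl(t) - t| ≤ 7 / 65 · |t|`, and `7 / 65` is
attained (`a = 13 / 8`, `b = -5 / 8`: `t = -65 / 64 ↦ -9 / 8`); kernel-exhaustive over all
`64 × 64` ordered pairs. -/
theorem E2M3_E3M2_mul_E2M3_relRD_normal :
    (∀ (a : MiniFloat E2M3) (b : MiniFloat E3M2),
        (1 : ℚ) ≤ |a.toRat * b.toRat| → |a.toRat * b.toRat| ≤ E2M3.maxRat →
          |(roundDown E2M3 (a.toRat * b.toRat)).toRat - (a.toRat * b.toRat)|
            ≤ 7 / 65 * |a.toRat * b.toRat|) ∧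
      ∃ (a : MiniFloat E2M3) (b : MiniFloat E3M2),
        (1 : ℚ) ≤ |a.toRat * b.toRat| ∧ |a.toRat * b.toRat| ≤ E2M3.maxRat ∧
          |(roundDown E2M3 (a.toRat * b.toRat)).toRat - (a.toRat * b.toRat)|
            = 7 / 65 * |a.toRat * b.toRat| :=
  ⟨fun a b => of_decide_eq_true (forall₂_of_all_all
      (P := relDirTest E2M3 (roundDown E2M3) (· * ·) (1) (7 / 65))
      (by decide +kernel) a b),
    ⟨false, 1, 5, by decide, by decide, by decide⟩,
    ⟨true, 2, 1, by decide, by decide, by decide⟩, by decide +kernel⟩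

/-- `E2M3 * E3M2 → E2M3` under `RU` (`roundUp`): on the normal range `1 ≤ |t| ≤ 15 / 2`
of `E2M3` every in-range product satisfies `|fl(t) - t| ≤ 7 / 65 · |t|`, and `7 / 65` is
attained (`a = 13 / 8`, `b = 5 / 8`: `t = 65 / 64 ↦ 9 / 8`); kernel-exhaustive over all
`64 × 64` ordered pairs. -/
theorem E2M3_E3M2_mul_E2M3_relRU_normal :
    (∀ (a : MiniFloat E2M3) (b : MiniFloat E3M2),
        (1 : ℚ) ≤ |a.toRat * b.toRat| → |a.toRat * b.toRat| ≤ E2M3.maxRat →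
          |(roundUp E2M3 (a.toRat * b.toRat)).toRat - (a.toRat * b.toRat)|
            ≤ 7 / 65 * |a.toRat * b.toRat|) ∧
      ∃ (a : MiniFloat E2M3) (b : MiniFloat E3M2),
        (1 : ℚ) ≤ |a.toRat * b.toRat| ∧ |a.toRat * b.toRat| ≤ E2M3.maxRat ∧
          |(roundUp E2M3 (a.toRat * b.toRat)).toRat - (a.toRat * b.toRat)|
            = 7 / 65 * |a.toRat * b.toRat| :=
  ⟨fun a b => of_decide_eq_true (forall₂_of_all_all
      (P := relDirTest E2M3 (roundUp E2M3) (· * ·) (1) (7 / 65))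
      (by decide +kernel) a b),
    ⟨false, 1, 5, by decide, by decide, by decide⟩,
    ⟨false, 2, 1, by decide, by decide, by decide⟩, by decide +kernel⟩

/-- `E2M3 * E2M1 → E2M3` under `RZ` (`roundTowardZero`): on the normal range `1 ≤ |t| ≤ 15 / 2`
of `E2M3` every in-range product satisfies `|fl(t) - t| ≤ 1 / 13 · |t|`, and `1 / 13` is
attained (`a = 13 / 8`, `b = 3 / 2`: `t = 39 / 16 ↦ 9 / 4`); kernel-exhaustive over all
`64 × 16` ordered pairs. -/
theorem E2M3_E2M1_mul_E2M3_relRZ_normal :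
    (∀ (a : MiniFloat E2M3) (b : MiniFloat E2M1),
        (1 : ℚ) ≤ |a.toRat * b.toRat| → |a.toRat * b.toRat| ≤ E2M3.maxRat →
          |(roundTowardZero E2M3 (a.toRat * b.toRat)).toRat - (a.toRat * b.toRat)|
            ≤ 1 / 13 * |a.toRat * b.toRat|) ∧
      ∃ (a : MiniFloat E2M3) (b : MiniFloat E2M1),
        (1 : ℚ) ≤ |a.toRat * b.toRat| ∧ |a.toRat * b.toRat| ≤ E2M3.maxRat ∧
          |(roundTowardZero E2M3 (a.toRat * b.toRat)).toRat - (a.toRat * b.toRat)|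
            = 1 / 13 * |a.toRat * b.toRat| :=
  ⟨fun a b => of_decide_eq_true (forall₂_of_all_all
      (P := relDirTest E2M3 (roundTowardZero E2M3) (· * ·) (1) (1 / 13))
      (by decide +kernel) a b),
    ⟨false, 1, 5, by decide, by decide, by decide⟩,
    ⟨false, 1, 1, by decide, by decide, by decide⟩, by decide +kernel⟩

/-- `E2M3 * E2M1 → E2M3` under `RD` (`roundDown`): on the normal range `1 ≤ |t| ≤ 15 / 2`
of `E2M3` every in-range product satisfies `|fl(t) - t| ≤ 1 / 11 · |t|`, and `1 / 11` is
attained (`a = 11 / 8`, `b = -3 / 2`: `t = -33 / 16 ↦ -9 / 4`); kernel-exhaustive over all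
`64 × 16` ordered pairs. -/
theorem E2M3_E2M1_mul_E2M3_relRD_normal :
    (∀ (a : MiniFloat E2M3) (b : MiniFloat E2M1),
        (1 : ℚ) ≤ |a.toRat * b.toRat| → |a.toRat * b.toRat| ≤ E2M3.maxRat →
          |(roundDown E2M3 (a.toRat * b.toRat)).toRat - (a.toRat * b.toRat)|
            ≤ 1 / 11 * |a.toRat * b.toRat|) ∧
      ∃ (a : MiniFloat E2M3) (b : MiniFloat E2M1),
        (1 : ℚ) ≤ |a.toRat * b.toRat| ∧ |a.toRat * b.toRat| ≤ E2M3.maxRat ∧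
          |(roundDown E2M3 (a.toRat * b.toRat)).toRat - (a.toRat * b.toRat)|
            = 1 / 11 * |a.toRat * b.toRat| :=
  ⟨fun a b => of_decide_eq_true (forall₂_of_all_all
      (P := relDirTest E2M3 (roundDown E2M3) (· * ·) (1) (1 / 11))
      (by decide +kernel) a b),
    ⟨false, 1, 3, by decide, by decide, by decide⟩,
    ⟨true, 1, 1, by decide, by decide, by decide⟩, by decide +kernel⟩

/-- `E2M3 * E2M1 → E2M3` under `RU` (`roundUp`): on the normal range `1 ≤ |t| ≤ 15 / 2`
of `E2M3` every in-range product satisfies `|fl(t) - t| ≤ 1 / 11 · |t|`, and `1 / 11` is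
attained (`a = 11 / 8`, `b = 3 / 2`: `t = 33 / 16 ↦ 9 / 4`); kernel-exhaustive over all
`64 × 16` ordered pairs. -/
theorem E2M3_E2M1_mul_E2M3_relRU_normal :
    (∀ (a : MiniFloat E2M3) (b : MiniFloat E2M1),
        (1 : ℚ) ≤ |a.toRat * b.toRat| → |a.toRat * b.toRat| ≤ E2M3.maxRat →
          |(roundUp E2M3 (a.toRat * b.toRat)).toRat - (a.toRat * b.toRat)|
            ≤ 1 / 11 * |a.toRat * b.toRat|) ∧
      ∃ (a : MiniFloat E2M3) (b : MiniFloat E2M1),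
        (1 : ℚ) ≤ |a.toRat * b.toRat| ∧ |a.toRat * b.toRat| ≤ E2M3.maxRat ∧
          |(roundUp E2M3 (a.toRat * b.toRat)).toRat - (a.toRat * b.toRat)|
            = 1 / 11 * |a.toRat * b.toRat| :=
  ⟨fun a b => of_decide_eq_true (forall₂_of_all_all
      (P := relDirTest E2M3 (roundUp E2M3) (· * ·) (1) (1 / 11))
      (by decide +kernel) a b),
    ⟨false, 1, 3, by decide, by decide, by decide⟩,
    ⟨false, 1, 1, by decide, by decide, by decide⟩, by decide +kernel⟩

end Summit.Ventures.CertifiedArithmetic
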